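import Summits.QuantumFields.YangMills.Theorems.BalabanUVNodesN16OfEntryAtRecord13CoPH
import Summits.QuantumFields.YangMills.Theorems.BalabanUVNodesN16Stage3OfFamilyMat

/-!
# Route «BalabanUVNodes», crux K3⁸ `SpineGivenEndpointR13SepCoPHV` (stmt-QuantumFields-27366), node N16 = NE3 — THE TOP KNIT: NODE N16 AT dag-n22-e's NAMED STAGE-13 READING OF
# RECORD `readingOfRecord₁₃CoPH w1 ℓ₃ ne2 ne1` FROM NODE N05's Σ-OBJECT OF RECORD (p681888's conclusion at the matrix-valued dictionary `stage3OfFamilyMat F N`) AND NODE N07's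
# LINEAR LEAF, LETTERS CHOSEN — module 57 §4 (`hE`-keyed reading-level knit) ∘ module 58 §2 (the bridge N05-Σ ⟹ `hE`); the `h5 ↦ hN05` edition of module 37ᴴ

Cell `pub-ymgap`, seat `pub-ymgap-dag-n16-e` (R134 acceleration seat (a), strategy s2 = BY-NAME KNIT at the record; HUMAN RULING D-0062; chair R424 venue), generation 24,
module 59 (THEOREMS ONLY, 0 `def`, 0 `sorry`, standard axioms; Theses-free, importable).  `--kind proof --supports stmt-QuantumFields-27366 --as helper` (count-neutral;
proves NO registered stub).  `bears_on: R4∕N16 · edges N05 → N16, N07 → N16 · out-edge N16 → N21 · composite N27`.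

WHY (HOME `HANDOFF.md` §g23 «WHAT REMAINS — THE TOP KNIT (a)+(b)»; `LOCATED-N16-N05-RECORD-CURRENCY.md`).  Module 37ᴴ (`…N16OfEdgesAllTorusAtRecord13CoPH`, p545656) states node N16
at the reading of record from its two in-edges with node N05 read through `h5` — Thm-4 ∕ Prop-3 BODIES on the pinned all-torus members of n05-a's ORIGINAL ℤᵈ model `zdGF3` — which
node N05's object of record (the κ-periodic Σ-object over `zdGF3HP₂Per`, dag-n05-d p681888) does not serve.  Generation 23 typed the seam (p674123 … p683332); module 57 (p688434)
re-keyed the reading-level knit on N16's θ-free chain-entry object `hE`; module 58 (p688784) named the matrix-valued Stage-3 dictionary of the family `stage3OfFamilyMat F N`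
(node00's `stage3OfFamily F` has `𝔸 := ℂ`, N16's objects are `M_N(ℂ)`-valued) and proved the bridge `exists_entry_of_n05UniformP` (N05-Σ at `stage3OfFamilyMat F N` ⟹ `hE`).  THIS
MODULE composes them: the `h5 ↦ hN05` editions of module 37ᴴ §2 (R-β, `0 ≤ β ≤ 1`) and §1 (β = 1), plus the per-family `N16HolderAt` face dag-n21-d reads — `hN05 F` being
p681888's CONCLUSION TEXT at `θ := stage3OfFamilyMat F N`, period family `ν ↦ ne3NperOfRecord₁₁ F 0 0 · F.L^ν`, pin equations dropped, with the pins `(Mκ, Rκ)` and the Hölder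
length letter `len` (`len ≥ 1` on its support, `len (e μ) = 1`) existential per family.  A consumer holding node N06's per-period binders at `stage3OfFamilyMat F N` discharges
`hN05 F` by `⟨Mκ, Rκ, len, hlen, hlen1, (p681888 (stage3OfFamilyMat F N) … (Pf := fun ν ↦ ne3NperOfRecord₁₁ F 0 0 * F.L ^ ν.1) …).…⟩` (three pin equations dropped).

WHAT IS PROVED ([folklore] composition BY NAME; no estimate).  ★★★ `exists_letters_s_N16Holder_readingOfRecord₁₃CoPHOn_of_n05UniformP` · `…₁₃CoPH_of_n05UniformP` (`0 ≤ β ≤ 1`) ·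
★★ `exists_letters_n16HolderAt_of_n05UniformP` (per family) · ★★★ `exists_letters_s_N16_readingOfRecord₁₃CoPHOn_of_n05UniformP` · `…₁₃CoPH_of_n05UniformP` (β = 1).

HONEST FRAMING.  Composition BY NAME; no estimate of Bałaban's is proved here.  `hN05` (node N05's Σ-object: [Balaban1985RegularSpaces] Thm 4 ∕ Prop 3 BODIES with ONE threshold
pair at every print-class periodic member of every period) and `h7` (node N07's [Balaban1985Variational] Thm 1 (8)+(10) TYPE, linear letters) are DISPLAYED HYPOTHESES asserted for no
family; node N05's p681888 inhabits `hN05 F` at `stage3OfFamilyMat F N` GIVEN node N06's five per-period analytic binders and [4]'s periodic letter families THERE (N06 content, NOT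
discharged; the tree's N06 object layer of record sits at `stage3OfFamily F`, `𝔸 = ℂ`); `w1` ∕ `ne2` ∕ `ne1` are residual DATA; no admissible Stage-13 tuple is claimed to exist (K0
OPEN); no stub of K3⁸ v7 closed or claimed; **N16 ∕ N05 ∕ N06 ∕ N07 ∕ N27 NOT discharged**; counts UNMOVED (typed 28∕28 · discharged 7∕27 · A 7∕28 — the chair's line is the only
count).  One finite four-torus at fixed `ε`, Bałaban AS PRINTED — NOT ℝ⁴, NOT infinite volume, NOT OS, NOT a mass gap; the Yang–Mills mass gap (Clay) is NOT proved by any of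
this — R4 closes the conditional finite-𝕋⁴ rung `BalabanLadder.UV` only.
References: [Balaban1985RegularSpaces] T. Bałaban, CMP **99** (1985) 75–102, Thm 4 p. 88 («There exists a constant c₁»), Prop. 3 p. 87, (1.36)–(1.39) pp. 82–83, p. 77;
[Balaban1985Variational] T. Bałaban, CMP **102** (1985) 277–309, Thm 1 p. 279.
-/

set_option autoImplicit false

open scoped BigOperators Matrix Matrix.Norms.L2Operator
open NormedSpace

namespace Summit.QuantumFields.YangMills.BalabanUVNodes.N16OfN05UniformPAtRecord13CoPH

open Literature.MathematicalPhysics.QuantumFieldTheory.Balaban1983to89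
open Literature.MathematicalPhysics.QuantumFieldTheory.Balaban1983to89.T4Continuum (T4Family ULoop)
open B7Prop1Explicit B7Prop2Explicit
open B8LeafModelZdHP2Per (zdGF3HP₂Per)
open Node00 (Stage13HParams IdxB8SubDPerκ NE3Objects₁₁ NE3Letters₁₁ NE2Objects₁₁ ne3ConstLayerOfRecord₁₁ ne3NperOfRecord₁₁ ne3DomOfRecord₁₁ one_le_ne3NperOfRecord₁₁ MatA)
open Node00.W1 (ReadingData)
open Summit.QuantumFields.BalabanUV.T4Continuum
open NE3.LeafIndexSockets (LeafH3sup)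
open YMDAG.UVSplit (NE3Carriers NE1pCarriers S_N16 ne3OfRecord₁₁ RRec₁₃CoPH RRec₁₃CoPHOn readingOfRecord₁₃CoPH)
open Summit.QuantumFields.YangMills.BalabanUVNodes.N16Regime (PrintSlot)
open Summit.QuantumFields.YangMills.BalabanUVNodes.N16HolderDefs (N16HolderAt S_N16Holder)
open Summit.QuantumFields.YangMills.BalabanUVNodes.N16HolderRegime (PrintSlotHolder InEndRegimeH radiusOfRecordH constOfRecordH)
open Summit.QuantumFields.YangMills.BalabanUVNodes.N16OfEntryAtRecord13CoPH (exists_letters_n16HolderAt_of_entry exists_letters_s_N16Holder_readingOfRecord₁₃CoPHOn_of_entry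
  exists_letters_s_N16Holder_readingOfRecord₁₃CoPH_of_entry exists_letters_s_N16_readingOfRecord₁₃CoPHOn_of_entry exists_letters_s_N16_readingOfRecord₁₃CoPH_of_entry)
open Summit.QuantumFields.YangMills.BalabanUVNodes.N16Stage3OfFamilyMat (stage3OfFamilyMat exists_entry_of_n05UniformP)
-- `Site` alone could resolve to the torus sites; re-export the `ℤ^d` sites of `B7Prop1Explicit`.
export B7Prop1Explicit (Site)

noncomputable section

variable {N : ℕ}

section Holder

variable [NeZero N] {β : ℝ} (hβ0 : 0 ≤ β) (hβ1 : β ≤ 1)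
variable (Rg : (F : T4Family) → Stage13HParams F N → Prop)
  (w1 : (F : T4Family) → (θ : Stage13HParams F N) → ReadingData F (MatA N) θ.τ9.M)
  (ne2 : (F : T4Family) → Stage13HParams F N → (ℕ → ℝ) → List (ULoop F) → ℕ → NE2Objects₁₁)
  (ne1 : (F : T4Family) → Stage13HParams F N → (ℕ → ℝ) → List (ULoop F) → NE1pCarriers)
include hβ0 hβ1

/-- **★★★ THE TOP KNIT — N16 UNDER R-β AT THE REGIME-RESTRICTED READING OF RECORD FROM NODE N05's Σ-OBJECT AND N07's LINEAR LEAF, LETTERS CHOSEN** (`0 ≤ β ≤ 1`).  `hN05 F` =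
node N05's p681888 conclusion text at the matrix-valued dictionary `stage3OfFamilyMat F N`, periods `ne3NperOfRecord₁₁ F 0 0 · F.Lᵏ` (pins `Mκ Rκ` and the Hölder length letter
`len` existential per family), `h7 F` = node N07's linear leaf; THEN letters of record `ℓ₃` with the composer's `h16 : S_N16Holder β (RRec₁₃CoPHOn (readingOfRecord₁₃CoPH w1 ℓ₃ ne2 ne1) Rg)`
and, per family, the identities, dag-n21-d's numerals, THE END's β-uniform proviso and dag-n16-c's PRINT β-slot — module 57 §4 ∘ module 58 §2; `Rg`, `w1`, `ne2`, `ne1` free.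
[cite: Balaban1985RegularSpaces, Thm 4 p.88, Prop. 3 p.87, p.77; Balaban1985Variational, Thm 1 p.279] [folklore] -/
theorem exists_letters_s_N16Holder_readingOfRecord₁₃CoPHOn_of_n05UniformP {g : T4Family → ℝ} (hg : ∀ F, 0 < g F)
    (hN05 : ∀ F : T4Family, letI : CStarAlgebra (Matrix (Fin N) (Fin N) ℂ) := B10Eq29TubeLine.cstarAlgebraMatrix N
      ∃ (Mκ Rκ : ℕ) (len : Site 4 → ℝ), (∀ v : Site 4, 0 < len v → 1 ≤ len v) ∧ (∀ μ : Fin 4, len (e μ) = 1) ∧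
      ∃ (inp : B8.B9Inputs) (B₀β B₈ c₄ c₃ : ℝ), inp.B₀ ≤ B₈ ∧ 0 < c₄ ∧ 0 < c₃ ∧
        ∀ (ν : {k : ℕ // 1 ≤ k}) (a : IdxB8SubDPerκ (stage3OfFamilyMat F N) (ne3NperOfRecord₁₁ F 0 0 * F.L ^ ν.1) Mκ Rκ),
          B8.Thm4Body c₄ (5 * ((4 : ℕ) : ℝ) * F.L * B₈)
            (fun _ : Unit => (zdGF3HP₂Per (Matrix (Fin N) (Fin N) ℂ) F.L β len a.toZdIdx (ne3NperOfRecord₁₁ F 0 0 * F.L ^ ν.1)).toGFData) ∧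
          B8.Prop3Body c₃ 4 (F.L : ℝ) (2097152 * (((4 : ℕ) : ℝ) + 1) ^ 2 * (F.L : ℝ) ^ 2) inp B₀β
            (fun _ : Unit => (zdGF3HP₂Per (Matrix (Fin N) (Fin N) ℂ) F.L β len a.toZdIdx (ne3NperOfRecord₁₁ F 0 0 * F.L ^ ν.1)).toGFData2))
    (h7 : ∀ F : T4Family, ∃ C ε₀ : ℝ, 0 ≤ C ∧ 0 < ε₀ ∧ ∀ ε : ℝ, 0 < ε → ε ≤ ε₀ →
      LeafH3sup 4 F.L (ne3NperOfRecord₁₁ F 0 0) ε (C * ε) (C * ε) (ne3DomOfRecord₁₁ F N 0 0)) :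
    ∃ ℓ₃ : T4Family → NE3Letters₁₁,
      S_N16Holder β (RRec₁₃CoPHOn (readingOfRecord₁₃CoPH w1 ℓ₃ ne2 ne1) Rg) ∧
      ∀ F : T4Family, (ℓ₃ F).g = g F ∧ (ℓ₃ F).Λ₁ = radiusOfRecordH N F.L (ne3NperOfRecord₁₁ F 0 0) ∧
        (ℓ₃ F).C = constOfRecordH N F.L (ne3NperOfRecord₁₁ F 0 0) (g F) ∧
        0 < (ℓ₃ F).b ∧ 512 * (4 + 1) * (4 + 4) * (F.L : ℝ) ^ 2 * (ℓ₃ F).b ≤ 1 ∧ 0 < (ℓ₃ F).Λ₂' ∧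
        InEndRegimeH (ne3OfRecord₁₁ F (ne3ConstLayerOfRecord₁₁ F N (ℓ₃ F))) ∧ PrintSlotHolder (ne3OfRecord₁₁ F (ne3ConstLayerOfRecord₁₁ F N (ℓ₃ F))) β :=
  exists_letters_s_N16Holder_readingOfRecord₁₃CoPHOn_of_entry hβ1 Rg w1 ne2 ne1 hg
    (fun F => by
      obtain ⟨Mκ, Rκ, len, hlen, hlen1, h⟩ := hN05 F
      exact exists_entry_of_n05UniformP F N (one_le_ne3NperOfRecord₁₁ F 0 0) Mκ Rκ hβ0 hlen hlen1 h) h7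

/-- **★★★ THE SAME AT THE CANONICAL READING OF RECORD** (`S_N16Holder β (RRec₁₃CoPH (readingOfRecord₁₃CoPH w1 ℓ₃ ne2 ne1))`; module 57 §4 ∘ module 58 §2).
[cite: Balaban1985RegularSpaces, Thm 4 p.88, Prop. 3 p.87] [folklore] -/
theorem exists_letters_s_N16Holder_readingOfRecord₁₃CoPH_of_n05UniformP {g : T4Family → ℝ} (hg : ∀ F, 0 < g F)
    (hN05 : ∀ F : T4Family, letI : CStarAlgebra (Matrix (Fin N) (Fin N) ℂ) := B10Eq29TubeLine.cstarAlgebraMatrix N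
      ∃ (Mκ Rκ : ℕ) (len : Site 4 → ℝ), (∀ v : Site 4, 0 < len v → 1 ≤ len v) ∧ (∀ μ : Fin 4, len (e μ) = 1) ∧
      ∃ (inp : B8.B9Inputs) (B₀β B₈ c₄ c₃ : ℝ), inp.B₀ ≤ B₈ ∧ 0 < c₄ ∧ 0 < c₃ ∧
        ∀ (ν : {k : ℕ // 1 ≤ k}) (a : IdxB8SubDPerκ (stage3OfFamilyMat F N) (ne3NperOfRecord₁₁ F 0 0 * F.L ^ ν.1) Mκ Rκ),
          B8.Thm4Body c₄ (5 * ((4 : ℕ) : ℝ) * F.L * B₈)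
            (fun _ : Unit => (zdGF3HP₂Per (Matrix (Fin N) (Fin N) ℂ) F.L β len a.toZdIdx (ne3NperOfRecord₁₁ F 0 0 * F.L ^ ν.1)).toGFData) ∧
          B8.Prop3Body c₃ 4 (F.L : ℝ) (2097152 * (((4 : ℕ) : ℝ) + 1) ^ 2 * (F.L : ℝ) ^ 2) inp B₀β
            (fun _ : Unit => (zdGF3HP₂Per (Matrix (Fin N) (Fin N) ℂ) F.L β len a.toZdIdx (ne3NperOfRecord₁₁ F 0 0 * F.L ^ ν.1)).toGFData2))
    (h7 : ∀ F : T4Family, ∃ C ε₀ : ℝ, 0 ≤ C ∧ 0 < ε₀ ∧ ∀ ε : ℝ, 0 < ε → ε ≤ ε₀ →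
      LeafH3sup 4 F.L (ne3NperOfRecord₁₁ F 0 0) ε (C * ε) (C * ε) (ne3DomOfRecord₁₁ F N 0 0)) :
    ∃ ℓ₃ : T4Family → NE3Letters₁₁,
      S_N16Holder β (RRec₁₃CoPH (readingOfRecord₁₃CoPH w1 ℓ₃ ne2 ne1)) ∧
      ∀ F : T4Family, (ℓ₃ F).g = g F ∧ (ℓ₃ F).Λ₁ = radiusOfRecordH N F.L (ne3NperOfRecord₁₁ F 0 0) ∧
        (ℓ₃ F).C = constOfRecordH N F.L (ne3NperOfRecord₁₁ F 0 0) (g F) ∧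
        0 < (ℓ₃ F).b ∧ 512 * (4 + 1) * (4 + 4) * (F.L : ℝ) ^ 2 * (ℓ₃ F).b ≤ 1 ∧ 0 < (ℓ₃ F).Λ₂' ∧
        InEndRegimeH (ne3OfRecord₁₁ F (ne3ConstLayerOfRecord₁₁ F N (ℓ₃ F))) ∧ PrintSlotHolder (ne3OfRecord₁₁ F (ne3ConstLayerOfRecord₁₁ F N (ℓ₃ F))) β :=
  exists_letters_s_N16Holder_readingOfRecord₁₃CoPH_of_entry hβ1 w1 ne2 ne1 hg
    (fun F => by
      obtain ⟨Mκ, Rκ, len, hlen, hlen1, h⟩ := hN05 F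
      exact exists_entry_of_n05UniformP F N (one_le_ne3NperOfRecord₁₁ F 0 0) Mκ Rκ hβ0 hlen hlen1 h) h7

omit hβ1 in
/-- **★★ PER FAMILY: `N16HolderAt · β` AT LETTERS OF RECORD FROM NODE N05's Σ-OBJECT AND N07's LINEAR LEAF** (`0 ≤ β ≤ 1`) — module 57's `exists_letters_n16HolderAt_of_entry` ∘
module 58 §2 (what dag-n21-d's N21 face reads at ₁₃, `N16HolderAt` unfolded = the β-root `CovRootHolder` at RR-1's letters and data of record). [cite: Balaban1985RegularSpaces, Thm 4 p.88, Prop. 3 p.87] [folklore] -/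
theorem exists_letters_n16HolderAt_of_n05UniformP (hβ1' : β ≤ 1) (F : T4Family) {g : ℝ} (hg : 0 < g)
    (hN05F : letI : CStarAlgebra (Matrix (Fin N) (Fin N) ℂ) := B10Eq29TubeLine.cstarAlgebraMatrix N
      ∃ (Mκ Rκ : ℕ) (len : Site 4 → ℝ), (∀ v : Site 4, 0 < len v → 1 ≤ len v) ∧ (∀ μ : Fin 4, len (e μ) = 1) ∧
      ∃ (inp : B8.B9Inputs) (B₀β B₈ c₄ c₃ : ℝ), inp.B₀ ≤ B₈ ∧ 0 < c₄ ∧ 0 < c₃ ∧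
        ∀ (ν : {k : ℕ // 1 ≤ k}) (a : IdxB8SubDPerκ (stage3OfFamilyMat F N) (ne3NperOfRecord₁₁ F 0 0 * F.L ^ ν.1) Mκ Rκ),
          B8.Thm4Body c₄ (5 * ((4 : ℕ) : ℝ) * F.L * B₈)
            (fun _ : Unit => (zdGF3HP₂Per (Matrix (Fin N) (Fin N) ℂ) F.L β len a.toZdIdx (ne3NperOfRecord₁₁ F 0 0 * F.L ^ ν.1)).toGFData) ∧
          B8.Prop3Body c₃ 4 (F.L : ℝ) (2097152 * (((4 : ℕ) : ℝ) + 1) ^ 2 * (F.L : ℝ) ^ 2) inp B₀β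
            (fun _ : Unit => (zdGF3HP₂Per (Matrix (Fin N) (Fin N) ℂ) F.L β len a.toZdIdx (ne3NperOfRecord₁₁ F 0 0 * F.L ^ ν.1)).toGFData2))
    (h7F : ∃ C ε₀ : ℝ, 0 ≤ C ∧ 0 < ε₀ ∧ ∀ ε : ℝ, 0 < ε → ε ≤ ε₀ →
      LeafH3sup 4 F.L (ne3NperOfRecord₁₁ F 0 0) ε (C * ε) (C * ε) (ne3DomOfRecord₁₁ F N 0 0)) :
    ∃ ℓ : NE3Letters₁₁, ℓ.g = g ∧ ℓ.Λ₁ = radiusOfRecordH N F.L (ne3NperOfRecord₁₁ F 0 0) ∧ ℓ.C = constOfRecordH N F.L (ne3NperOfRecord₁₁ F 0 0) g ∧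
      0 < ℓ.b ∧ 512 * (4 + 1) * (4 + 4) * (F.L : ℝ) ^ 2 * ℓ.b ≤ 1 ∧ 0 < ℓ.Λ₂' ∧
      InEndRegimeH (ne3OfRecord₁₁ F (ne3ConstLayerOfRecord₁₁ F N ℓ)) ∧ PrintSlotHolder (ne3OfRecord₁₁ F (ne3ConstLayerOfRecord₁₁ F N ℓ)) β ∧
      N16HolderAt (ne3OfRecord₁₁ F (ne3ConstLayerOfRecord₁₁ F N ℓ)) β := by
  obtain ⟨Mκ, Rκ, len, hlen, hlen1, h⟩ := hN05F
  exact exists_letters_n16HolderAt_of_entry hβ1' F hg (exists_entry_of_n05UniformP F N (one_le_ne3NperOfRecord₁₁ F 0 0) Mκ Rκ hβ0 hlen hlen1 h) h7F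

end Holder

section One

variable [NeZero N]
variable (Rg : (F : T4Family) → Stage13HParams F N → Prop)
  (w1 : (F : T4Family) → (θ : Stage13HParams F N) → ReadingData F (MatA N) θ.τ9.M)
  (ne2 : (F : T4Family) → Stage13HParams F N → (ℕ → ℝ) → List (ULoop F) → ℕ → NE2Objects₁₁)
  (ne1 : (F : T4Family) → Stage13HParams F N → (ℕ → ℝ) → List (ULoop F) → NE1pCarriers)

/-- **★★★ THE TOP KNIT AT THE EXPONENT OF RECORD (β = 1) — THE STUB OF RECORD `S_N16` AT THE REGIME-RESTRICTED READING OF RECORD FROM NODE N05's Σ-OBJECT AT EXPONENT `1`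
AND N07's LINEAR LEAF** — module 57 §4 (β = 1) ∘ module 58 §2: `h16 : S_N16 (RRec₁₃CoPHOn (readingOfRecord₁₃CoPH w1 ℓ₃ ne2 ne1) Rg)`, per-family identities, numerals, β-uniform proviso
and n16-e's PRINT SLOT OF RECORD `PrintSlot`. [cite: Balaban1985RegularSpaces, Thm 4 p.88, Prop. 3 p.87; Balaban1985Variational, Thm 1 p.279] [folklore] -/
theorem exists_letters_s_N16_readingOfRecord₁₃CoPHOn_of_n05UniformP {g : T4Family → ℝ} (hg : ∀ F, 0 < g F)
    (hN05 : ∀ F : T4Family, letI : CStarAlgebra (Matrix (Fin N) (Fin N) ℂ) := B10Eq29TubeLine.cstarAlgebraMatrix N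
      ∃ (Mκ Rκ : ℕ) (len : Site 4 → ℝ), (∀ v : Site 4, 0 < len v → 1 ≤ len v) ∧ (∀ μ : Fin 4, len (e μ) = 1) ∧
      ∃ (inp : B8.B9Inputs) (B₀β B₈ c₄ c₃ : ℝ), inp.B₀ ≤ B₈ ∧ 0 < c₄ ∧ 0 < c₃ ∧
        ∀ (ν : {k : ℕ // 1 ≤ k}) (a : IdxB8SubDPerκ (stage3OfFamilyMat F N) (ne3NperOfRecord₁₁ F 0 0 * F.L ^ ν.1) Mκ Rκ),
          B8.Thm4Body c₄ (5 * ((4 : ℕ) : ℝ) * F.L * B₈)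
            (fun _ : Unit => (zdGF3HP₂Per (Matrix (Fin N) (Fin N) ℂ) F.L 1 len a.toZdIdx (ne3NperOfRecord₁₁ F 0 0 * F.L ^ ν.1)).toGFData) ∧
          B8.Prop3Body c₃ 4 (F.L : ℝ) (2097152 * (((4 : ℕ) : ℝ) + 1) ^ 2 * (F.L : ℝ) ^ 2) inp B₀β
            (fun _ : Unit => (zdGF3HP₂Per (Matrix (Fin N) (Fin N) ℂ) F.L 1 len a.toZdIdx (ne3NperOfRecord₁₁ F 0 0 * F.L ^ ν.1)).toGFData2))
    (h7 : ∀ F : T4Family, ∃ C ε₀ : ℝ, 0 ≤ C ∧ 0 < ε₀ ∧ ∀ ε : ℝ, 0 < ε → ε ≤ ε₀ →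
      LeafH3sup 4 F.L (ne3NperOfRecord₁₁ F 0 0) ε (C * ε) (C * ε) (ne3DomOfRecord₁₁ F N 0 0)) :
    ∃ ℓ₃ : T4Family → NE3Letters₁₁,
      S_N16 (RRec₁₃CoPHOn (readingOfRecord₁₃CoPH w1 ℓ₃ ne2 ne1) Rg) ∧
      ∀ F : T4Family, (ℓ₃ F).g = g F ∧ (ℓ₃ F).Λ₁ = radiusOfRecordH N F.L (ne3NperOfRecord₁₁ F 0 0) ∧
        (ℓ₃ F).C = constOfRecordH N F.L (ne3NperOfRecord₁₁ F 0 0) (g F) ∧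
        0 < (ℓ₃ F).b ∧ 512 * (4 + 1) * (4 + 4) * (F.L : ℝ) ^ 2 * (ℓ₃ F).b ≤ 1 ∧ 0 < (ℓ₃ F).Λ₂' ∧
        InEndRegimeH (ne3OfRecord₁₁ F (ne3ConstLayerOfRecord₁₁ F N (ℓ₃ F))) ∧ PrintSlot (ne3OfRecord₁₁ F (ne3ConstLayerOfRecord₁₁ F N (ℓ₃ F))) :=
  exists_letters_s_N16_readingOfRecord₁₃CoPHOn_of_entry Rg w1 ne2 ne1 hg
    (fun F => by
      obtain ⟨Mκ, Rκ, len, hlen, hlen1, h⟩ := hN05 F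
      exact exists_entry_of_n05UniformP F N (one_le_ne3NperOfRecord₁₁ F 0 0) Mκ Rκ zero_le_one hlen hlen1 h) h7

/-- **★★★ THE SAME AT THE CANONICAL READING OF RECORD** (`S_N16 (RRec₁₃CoPH (readingOfRecord₁₃CoPH w1 ℓ₃ ne2 ne1))`; module 57 §4 ∘ module 58 §2).
[cite: Balaban1985RegularSpaces, Thm 4 p.88, Prop. 3 p.87] [folklore] -/
theorem exists_letters_s_N16_readingOfRecord₁₃CoPH_of_n05UniformP {g : T4Family → ℝ} (hg : ∀ F, 0 < g F)
    (hN05 : ∀ F : T4Family, letI : CStarAlgebra (Matrix (Fin N) (Fin N) ℂ) := B10Eq29TubeLine.cstarAlgebraMatrix N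
      ∃ (Mκ Rκ : ℕ) (len : Site 4 → ℝ), (∀ v : Site 4, 0 < len v → 1 ≤ len v) ∧ (∀ μ : Fin 4, len (e μ) = 1) ∧
      ∃ (inp : B8.B9Inputs) (B₀β B₈ c₄ c₃ : ℝ), inp.B₀ ≤ B₈ ∧ 0 < c₄ ∧ 0 < c₃ ∧
        ∀ (ν : {k : ℕ // 1 ≤ k}) (a : IdxB8SubDPerκ (stage3OfFamilyMat F N) (ne3NperOfRecord₁₁ F 0 0 * F.L ^ ν.1) Mκ Rκ),
          B8.Thm4Body c₄ (5 * ((4 : ℕ) : ℝ) * F.L * B₈)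
            (fun _ : Unit => (zdGF3HP₂Per (Matrix (Fin N) (Fin N) ℂ) F.L 1 len a.toZdIdx (ne3NperOfRecord₁₁ F 0 0 * F.L ^ ν.1)).toGFData) ∧
          B8.Prop3Body c₃ 4 (F.L : ℝ) (2097152 * (((4 : ℕ) : ℝ) + 1) ^ 2 * (F.L : ℝ) ^ 2) inp B₀β
            (fun _ : Unit => (zdGF3HP₂Per (Matrix (Fin N) (Fin N) ℂ) F.L 1 len a.toZdIdx (ne3NperOfRecord₁₁ F 0 0 * F.L ^ ν.1)).toGFData2))
    (h7 : ∀ F : T4Family, ∃ C ε₀ : ℝ, 0 ≤ C ∧ 0 < ε₀ ∧ ∀ ε : ℝ, 0 < ε → ε ≤ ε₀ →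
      LeafH3sup 4 F.L (ne3NperOfRecord₁₁ F 0 0) ε (C * ε) (C * ε) (ne3DomOfRecord₁₁ F N 0 0)) :
    ∃ ℓ₃ : T4Family → NE3Letters₁₁,
      S_N16 (RRec₁₃CoPH (readingOfRecord₁₃CoPH w1 ℓ₃ ne2 ne1)) ∧
      ∀ F : T4Family, (ℓ₃ F).g = g F ∧ (ℓ₃ F).Λ₁ = radiusOfRecordH N F.L (ne3NperOfRecord₁₁ F 0 0) ∧
        (ℓ₃ F).C = constOfRecordH N F.L (ne3NperOfRecord₁₁ F 0 0) (g F) ∧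
        0 < (ℓ₃ F).b ∧ 512 * (4 + 1) * (4 + 4) * (F.L : ℝ) ^ 2 * (ℓ₃ F).b ≤ 1 ∧ 0 < (ℓ₃ F).Λ₂' ∧
        InEndRegimeH (ne3OfRecord₁₁ F (ne3ConstLayerOfRecord₁₁ F N (ℓ₃ F))) ∧ PrintSlot (ne3OfRecord₁₁ F (ne3ConstLayerOfRecord₁₁ F N (ℓ₃ F))) :=
  exists_letters_s_N16_readingOfRecord₁₃CoPH_of_entry w1 ne2 ne1 hg
    (fun F => by
      obtain ⟨Mκ, Rκ, len, hlen, hlen1, h⟩ := hN05 F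
      exact exists_entry_of_n05UniformP F N (one_le_ne3NperOfRecord₁₁ F 0 0) Mκ Rκ zero_le_one hlen hlen1 h) h7

end One

end

end Summit.QuantumFields.YangMills.BalabanUVNodes.N16OfN05UniformPAtRecord13CoPH
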